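import Summits.CriticalPhenomena.Ising3DConformalLimit.Theses.ArmHyperscaling
import Literature.Barriers.CriticalPhenomena.RandomClusterFirstOrder
import HarnessLib

/-!
# Sketch — crux `OneArmHyperscaling` (stmt-CriticalPhenomena-15591), idea `wall-cost-screening`

First-lemma signatures only (crux-ideate stage; no proofs are claimed, `sorry` placeholders).

Line: `OneArmHyperscaling ⇐ BoundedWallCost ∧ FreeArmBound`, where

* `BoundedWallCost` — the critical `+/−` DOMAIN-WALL FREE ENERGY of the cubical shells
  `A_{K,m} = Λ_{Km} ∖ Λ_m` is bounded at SOME fixed ratio `K ≥ 2`: `Z⁺⁺(A_{K,m}) ≤ C · Z⁺⁻(A_{K,m})`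
  uniformly in `m` (plus on the hole `Λ_m`, plus resp. minus outside `Λ_{Km}`; `β = β_c(3)`, `h = 0`;
  the ratio is non-increasing in `K` by GKS, and for `K = 2` the constant is film-like, `log C ≈ 170`
  numerically, so larger `K` is the practical form).  By Aizenman 2025 (arXiv:2509.02850, Thm 7.6)
  `Z⁺⁻/Z⁺⁺ = P^{FK(2),+}[∂Λ_m ↮ ∂Λ_{Km}]`, so this is the same as: the doubly-wired critical FK-Ising
  shell is NOT crossed with probability ≥ c (an RSW substitute); it is the d = 3 content (false for
  d > 4, where the wall cost grows like R^{d-4}).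
* `FreeArmBound` — the INFINITE-VOLUME (free) one-arm obeys hyperscaling against the two-point
  function: `θ_free(Kn)² ≤ C ⟨σ₀σ_{2ne₀}⟩_{β_c}` (weaker than the crux since `θ_free ≤ m⁺`; expected in
  every dimension).
* glue (FKG + domain Markov + monotonicity in the boundary condition, provable now):
  `BoundedWallCost → FreeArmBound → OneArmHyperscaling`.
-/

noncomputable section

namespace Summit.CriticalPhenomena.Ising3DConformalLimit.Cruxes.OneArmHyperscaling.WallCostScreening

open Literature.Probability.LatticeModels Literature.Barriers.CriticalPhenomena
open Literature.Probability.Percolation MeasureTheory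

/-- The cubical shell `A_{K,m} = Λ_{Km} ∖ Λ_m`. [folklore] -/
def shell (K m : ℕ) : Finset (Site 3) := box 3 (K * m) \ box 3 m

/-- The radial `+/−` boundary configuration: `+1` on the hole `Λ_m`, `−1` elsewhere (only its values
off the shell matter). [folklore] -/
def radialPlusMinus (m : ℕ) : SpinConfig (Site 3) := fun x => if x ∈ box 3 m then 1 else -1

/-- `Z⁺⁺(A_{K,m})`: critical partition function of the shell with `+` spins on both boundary components. [folklore] -/
def shellZpp (K m : ℕ) : ℝ :=
  isingPartitionFunction (zdGraph 3) (shell K m) (criticalBeta 3) 0 BoundaryCondition.plus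

/-- `Z⁺⁻(A_{K,m})`: critical partition function of the shell with `+` inside (on `Λ_m`) and `−` outside
(`Λ_{Km}ᶜ`). [folklore] -/
def shellZpm (K m : ℕ) : ℝ :=
  isingPartitionFunction (zdGraph 3) (shell K m) (criticalBeta 3) 0 (.fixed (radialPlusMinus m))

/-- **(BWC) bounded critical wall cost** — the open core of the line: at some fixed ratio `K ≥ 2` the
`+/−` domain-wall free energy `log (Z⁺⁺/Z⁺⁻)` of the shells `Λ_{Km} ∖ Λ_m` at `β_c(3)` is bounded
uniformly in `m`. [folklore] -/
def BoundedWallCost : Prop :=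
  ∃ K : ℕ, 2 ≤ K ∧ ∃ C : ℝ, ∀ m : ℕ, 1 ≤ m → shellZpp K m ≤ C * shellZpm K m

/-- The critical FK-Ising parameter `p_c = 1 − e^{−2β_c(3)}`. [folklore] -/
def pcrit : ℝ := fkIsingParam (criticalBeta 3)

/-- `φ¹_{Λ_L}(0 ↔ ∂Λ_R)`: under the WIRED critical FK-Ising measure of the box `Λ_L`, the origin is
joined by an open path to a vertex of the inner sphere `∂Λ_R` (for `R ≤ L`). [folklore] -/
def wiredBoxArmTo (R L : ℕ) : ℝ :=
  (rcMeasure (boxGraph 3 L) pcrit 2 (boxBoundary 3 L)).real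
    {ω | ∃ y : BoxV 3 L, y.1 ∈ innerBoundary (zdGraph 3) (box 3 R) ∧
      (openGraph ω).Reachable (boxOrigin 3 L) y}

/-- **Free (infinite-volume) one-arm** `θ_free(R) = φ_{ℤ³,β_c}(0 ↔ ∂Λ_R)`, written as the infimum over
wired boxes `Λ_{R+L+1} ⊇ Λ_R` (the wired probabilities decrease in `L` to the infinite-volume one; the
critical FK-Ising measure on `ℤ³` is unique). [folklore] -/
def freeArm (R : ℕ) : ℝ := ⨅ L : ℕ, wiredBoxArmTo R (R + L + 1)

/-- **(FAB) free one-arm hyperscaling bound**: `θ_free(Kn)² ≤ C ⟨σ₀σ_{2ne₀}⟩_{β_c}` — the crux with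
the wired box arm replaced by the infinite-volume arm (weaker: `θ_free(Kn) ≤ m⁺_{Kn}`). [folklore] -/
def FreeArmBound : Prop :=
  ∃ K : ℕ, 1 ≤ K ∧ ∃ C : ℝ, ∀ n : ℕ, 1 ≤ n →
    freeArm (K * n) ^ 2 ≤ C * criticalTwoPoint 3 (Pi.single 0 (2 * (n : ℤ)))

/-- **First lemma of the line (glue; FKG + domain Markov + boundary-condition monotonicity +
Edwards–Sokal with two boundary components, Aizenman 2025 Thm 7.6):**
bounded wall cost and the free one-arm bound give the crux by name. [folklore] -/
theorem OneArmHyperscaling_of_wallCost :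
    BoundedWallCost → FreeArmBound →
      Summit.CriticalPhenomena.Ising3DConformalLimit.Theses.ArmHyperscaling.OneArmHyperscaling := by
  sorry

/-- **Screening lemma (the mechanism, provable now):** the wall cost of the shell `Λ_{Km} ∖ Λ_m`
controls how much the wired box `Λ_{Km}` can exceed any larger wired box (hence the infinite-volume
state) on increasing `Λ_m`-local connection events: factor `(1 + Z⁺⁺/Z⁺⁻)/2`; stated for the
one-arm-to-`∂Λ_R` event from the origin, `R ≤ m`. [folklore] -/
theorem wiredArm_le_of_wallCost (K m R L : ℕ) (hK : 2 ≤ K) (hR : R ≤ m) (hL : K * m ≤ L) (hm : 1 ≤ m) :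
    wiredBoxArmTo R (K * m) ≤ (1 + shellZpp K m / shellZpm K m) / 2 * wiredBoxArmTo R L := by
  sorry

end Summit.CriticalPhenomena.Ising3DConformalLimit.Cruxes.OneArmHyperscaling.WallCostScreening

end
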